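import Mathlib
import Literature.Analysis.FluidPDE.TypeIAncientMild
import Literature.Analysis.FluidPDE.VectorCalculus
import Literature.Analysis.FluidPDE.MildSolution
import Summits.NavierStokesRegularity.NavierStokesRegularity.Theorems.ScenarioCensusAncient
import Summits.NavierStokesRegularity.NavierStokesRegularity.Theorems.PoloidalWindowDoorPoloidalWindowRigidityOneSlice
import Summits.NavierStokesRegularity.NavierStokesRegularity.Theorems.SymmetryModuliCountStretchingCertificateComparison
import Summits.NavierStokesRegularity.NavierStokesRegularity.Theorems.SqueezeCycleExtremalElementExistsExtraction
import Summits.NavierStokesRegularity.NavierStokesRegularity.Theorems.SqueezeCycleExtremalElementExistsRescale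
import HarnessLib

/-!
# Census rows A7h / A7hw (horizontal-valued Type-I ancient mild flows) — part 1/2: the class,
# vertical-vorticity extinction (S1), flat-slice rigidity, the bounded shift

Re-homed for the scenario census (typer seat; lead ORDER 2026-08-28T14:04Z) from ns-idea-2's line file
`pub/ideators/ns-idea-2/lines/horizontal-meter/line-horizontal-meter.lean` (LINE «horizontal-meter», rev 3; sha16 489b734424670ea8,
rc 0; its only `sorry`s are the A7hb stubs B1/B2, NOT re-homed) in two files for the 400-line rule:
`ScenarioCensusRowA7hExtinction` (this file) → `ScenarioCensusRowA7h` (rows, W1 compactness, compositions, census keys).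
Lean text verbatim in namespace `…ScenarioCensus.HorizontalMeter` (the line's `ℝ³` notation spelled out, the two
`Theses.SymmetryModuliCount` bridges and the sorried B-stubs dropped).

Contents: `IsHorizontalValued` (`u·e₃ ≡ 0` on `t < 0` — a VALUE constraint, no symmetry group), the bounded
KNSS-gauge class `IsBoundedKNSSMild`; S1 `verticalVorticityExtinction` (PROVED: the vorticity equation in the
Type-I class projected on `e₃` has no stretching term, weak maximum principle on slabs via the tree toolkit
`Theorems.vorticity_eq_deriv_of_typeI`, `le_of_subsolution_linear_drift`, `exists_gauge_norm_fderiv_le_of_typeI`);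
`flatSliceRigidity` (tree `PoloidalWindowDoorPoloidalWindowRigidityOneSlice.eq_zero_of_flat_slice_single_zero`);
`isBoundedKNSSMild_shift`.

No census value is asserted here (the lead books A7h / A7hw on the census); NS regularity is NOT proved;
no summit statement is proved by this file.
-/

set_option linter.dupNamespace false

noncomputable section

namespace Summit.NavierStokesRegularity.NavierStokesRegularity.Theorems.ScenarioCensus.HorizontalMeter

open Set Function Filter Topology MeasureTheory
open scoped RealInnerProductSpace InnerProductSpace NNReal Laplacian
open Literature.Analysis Literature.Analysis.FluidPDE
open Summit.NavierStokesRegularity.NavierStokesRegularity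

/-- The vertical unit vector `e₃` (coordinate index `2`). -/
abbrev e3 : (EuclideanSpace ℝ (Fin 3)) := EuclideanSpace.single 2 1

/-- **Horizontal-valued** on the ancient slab: the velocity is everywhere parallel to the fixed plane
`e₃^⊥`, i.e. its third component vanishes identically (`t < 0`).  A constraint on VALUES, not a
symmetry: the field may depend on all three coordinates. -/
def IsHorizontalValued (u : ℝ → (EuclideanSpace ℝ (Fin 3)) → (EuclideanSpace ℝ (Fin 3))) : Prop := ∀ t < 0, ∀ x, u t x 2 = 0

/-- The **bounded KNSS-gauge ancient mild class** (fields 1–3 of `IsTypeIAncientMild` — jointly smooth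
on `(−∞,0) × (EuclideanSpace ℝ (Fin 3))`, divergence-free slices, the Oseen integral equation between every pair of times —
plus a uniform bound instead of the Type-I rate; the gauge excludes the parasitic `b(t)`). -/
def IsBoundedKNSSMild (u : ℝ → (EuclideanSpace ℝ (Fin 3)) → (EuclideanSpace ℝ (Fin 3))) : Prop :=
  ContDiffOn ℝ (⊤ : ℕ∞) (uncurry u) (Iio 0 ×ˢ univ) ∧
    (∀ t < 0, VectorCalculus.IsDivFree (u t)) ∧
    (∀ s t : ℝ, s < t → t < 0 → ∀ x, u t x = heatFlow (u s) (t - s) x - oseenDuhamel 1 s u u t x) ∧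
    ∃ B : ℝ, ∀ t < 0, ∀ x, ‖u t x‖ ≤ B

/-! ## Obligations -/

/-- **S1 (crux, M) — vertical-vorticity extinction.**  For a KNSS-gauge Type-I ancient mild field with
`u·e₃ ≡ 0` the vertical vorticity `ω₃ = ∂₀u₁ − ∂₁u₀` vanishes on every slice.  Route: `ω₃` is a bounded
(class gradient rate `‖∇u(t)‖ ≤ C₁/(−t)`, tree `…ClassRate.exists_fderiv_rate_of_class`) classical solution of
`∂ₜω₃ + u·∇ω₃ = Δω₃` — NO stretching term, because `(ω·∇)u₃ ≡ 0` — with bounded smooth divergence-free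
drift on every slab `[t₁,t₂] ⊂ (−∞,0)`; the whole-space maximum principle for BOUNDED solutions
(Friedman Ch. 2 Thm 9; Phragmén–Lindelöf growth class) gives `sup|ω₃(t₂)| ≤ sup|ω₃(t₁)| ≤ 2C₁/(−t₁) → 0`
as `t₁ → −∞`.  Second route (no rate needed, = B1): KNSS Lemma 2.1 half-balls + circulation.
[KNSS2009 Lemma 2.1, Thm 5.1; Friedman1964 Ch.2 §4] -/
def VerticalVorticityExtinction : Prop :=
  ∀ (C : ℝ) (u : ℝ → (EuclideanSpace ℝ (Fin 3)) → (EuclideanSpace ℝ (Fin 3))), IsTypeIAncientMild C u → IsHorizontalValued u →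
    ∀ t < 0, ∀ y, ⟪curl (u t) y, e3⟫_ℝ = 0

/-- **S1 is PROVED (REV 2)** with the tree's weighted-vorticity maximum-principle toolkit of route
SymmetryModuliCount / ClockStretchingLaw (census A2g): the vorticity equation in the class
(`Theorems.vorticity_eq_deriv_of_typeI`) projected onto `e₃` loses its stretching term because
`y ↦ ⟪u(s, y), e₃⟫ ≡ 0`; so `±ω₃` are jointly smooth (`isSmoothSpaceTimeOn_vorticity_Iio`) solutions of
`∂ₛF + u·∇F = ΔF` with `|u| ≤ C/√(−t)` on every slab `[T₁, t]`, bounded by `κK₀/(−s)`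
(`exists_gauge_norm_fderiv_le_of_typeI`, `norm_curl_le`); the weak maximum principle on
`[T₁, t] × (EuclideanSpace ℝ (Fin 3))` (`Theorems.le_of_subsolution_linear_drift`) gives `±ω₃(t, x) ≤ κK₀/(−T₁) → 0`. -/
theorem verticalVorticityExtinction : VerticalVorticityExtinction := by
  intro C u hA hh t ht x
  have ht0 : 0 < -t := neg_pos.2 ht
  -- the inner product with `e₃` is the third coordinate
  have hinner : ∀ w : (EuclideanSpace ℝ (Fin 3)), ⟪w, e3⟫_ℝ = w 2 := fun w => by
    simp [e3, EuclideanSpace.inner_single_right]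
  rw [hinner]
  -- smoothness of the class and of its vorticity
  have hsm : IsSmoothSpaceTimeOn (Iio 0) u := hA.contDiffOn
  have hvsm : IsSmoothSpaceTimeOn (Iio 0) (vorticity u) :=
    Theorems.isSmoothSpaceTimeOn_vorticity_Iio hsm
  -- the class gradient gauge and the amplitude
  obtain ⟨K₀, hK₀⟩ := Theorems.exists_gauge_norm_fderiv_le_of_typeI C
  have hK₀u : ∀ s < 0, ∀ y, (-s) * ‖fderiv ℝ (u s) y‖ ≤ K₀ := hK₀ hA
  have hC0 : 0 ≤ C := hA.nonneg
  have hK00 : 0 ≤ K₀ :=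
    le_trans (by positivity : (0 : ℝ) ≤ (-(-1 : ℝ)) * ‖fderiv ℝ (u (-1)) 0‖)
      (hK₀u (-1) (by norm_num) 0)
  set A : ℝ := ‖curlCLM‖ * K₀ with hAdef
  have hA0 : 0 ≤ A := by rw [hAdef]; positivity
  -- |ω₃(s, y)| ≤ A / (−s)
  have hωbd : ∀ s < 0, ∀ y, |curl (u s) y 2| ≤ A / (-s) := by
    intro s hs y
    have hs0 : 0 < -s := neg_pos.2 hs
    have h1 : |curl (u s) y 2| ≤ ‖curl (u s) y‖ := by
      rw [← hinner, ← Real.norm_eq_abs]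
      calc ‖⟪curl (u s) y, e3⟫_ℝ‖ ≤ ‖curl (u s) y‖ * ‖e3‖ := norm_inner_le_norm _ _
        _ = ‖curl (u s) y‖ := by simp [e3]
    have h2 : ‖curl (u s) y‖ ≤ ‖curlCLM‖ * ‖fderiv ℝ (u s) y‖ := norm_curl_le _ _
    have h3 : ‖curlCLM‖ * ‖fderiv ℝ (u s) y‖ ≤ A / (-s) := by
      rw [hAdef, le_div_iff₀ hs0]
      calc ‖curlCLM‖ * ‖fderiv ℝ (u s) y‖ * (-s) = ‖curlCLM‖ * ((-s) * ‖fderiv ℝ (u s) y‖) := by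
            ring
        _ ≤ ‖curlCLM‖ * K₀ := by gcongr; exact hK₀u s hs y
    exact h1.trans (h2.trans h3)
  -- the projected vorticity equation: for a functional `L'` killing `u`, `F = L' ∘ ω` solves
  -- `∂ₛF + u·∇F = ΔF` (no stretching)
  have hpde : ∀ L' : (EuclideanSpace ℝ (Fin 3)) →L[ℝ] ℝ, (∀ s < 0, ∀ z, L' (u s z) = 0) → ∀ s < 0, ∀ y,
      deriv (fun r => L' (curl (u r) y)) s + fderiv ℝ (fun z => L' (curl (u s) z)) y (u s y) =
        (Δ (fun z => L' (curl (u s) z))) y := by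
    intro L' hL' s hs y
    have hv := Theorems.vorticity_eq_deriv_of_typeI hA hs y
    have hcurl2 : ContDiff ℝ 2 (curl (u s)) := (hvsm.contDiff_slice hs).of_le (by norm_cast)
    have hcd : DifferentiableAt ℝ (curl (u s)) y := (hcurl2.differentiable (by norm_num)) y
    have hud : DifferentiableAt ℝ (u s) y := ((hA.contDiff_slice hs).differentiable (by simp)) y
    have htime : HasDerivAt (fun r => curl (u r) y) (deriv (fun r => curl (u r) y) s) s :=
      hvsm.hasDerivAt_timeLine isOpen_Iio hs y
    have h1 : deriv (fun r => L' (curl (u r) y)) s = L' (deriv (fun r => curl (u r) y) s) :=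
      (L'.hasFDerivAt.comp_hasDerivAt s htime).deriv
    have h2 : fderiv ℝ (fun z => L' (curl (u s) z)) y = L'.comp (fderiv ℝ (curl (u s)) y) :=
      (L'.hasFDerivAt.comp y hcd.hasFDerivAt).fderiv
    have h3 : (Δ (fun z => L' (curl (u s) z))) y = L' ((Δ (curl (u s))) y) := by
      have := (hcurl2.contDiffAt (x := y)).laplacian_CLM_comp_left (l := L')
      simpa [Function.comp_def] using this
    have h4 : L' (fderiv ℝ (u s) y (curl (u s) y)) = 0 := by
      have e : fderiv ℝ (fun z => L' (u s z)) y = L'.comp (fderiv ℝ (u s) y) :=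
        (L'.hasFDerivAt.comp y hud.hasFDerivAt).fderiv
      have e0 : fderiv ℝ (fun z => L' (u s z)) y = 0 := by
        have : (fun z => L' (u s z)) = fun _ => (0 : ℝ) := funext fun z => hL' s hs z
        rw [this]
        simp
      have := congrArg (fun T : (EuclideanSpace ℝ (Fin 3)) →L[ℝ] ℝ => T (curl (u s) y)) (e.symm.trans e0)
      simpa using this
    have h5 := congrArg L' hv
    rw [map_add, map_add, h4, zero_add] at h5
    rw [h1, h2, h3, ContinuousLinearMap.comp_apply]
    exact h5
  -- the weak maximum principle from `T₁ → −∞` for such an `F` bounded by `A/(−s)`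
  have hmp : ∀ F : ℝ → (EuclideanSpace ℝ (Fin 3)) → ℝ, IsSmoothSpaceTimeOn (Iio 0) F →
      (∀ s < 0, ∀ y, deriv (fun r => F r y) s + fderiv ℝ (F s) y (u s y) = (Δ (F s)) y) →
      (∀ s < 0, ∀ y, F s y ≤ A / (-s)) → F t x ≤ 0 := by
    intro F hFsm hFpde hFbd
    have key : ∀ T₁ < t, F t x ≤ A / (-T₁) := by
      intro T₁ hT₁
      have hIcc : Icc T₁ t ⊆ Iio 0 := fun s hs => lt_of_le_of_lt hs.2 ht
      set K : ℝ := C / Real.sqrt (-t) with hK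
      have hK0 : 0 ≤ K := div_nonneg hC0 (Real.sqrt_nonneg _)
      refine Theorems.le_of_subsolution_linear_drift (T₁ := T₁) (T₂ := t) (B := A / (-t)) hK0
        (P := F) (Pₜ := fun s y => deriv (fun r => F r y) s) ?_ ?_ ?_ ?_ ?_ ?_ t ⟨hT₁.le, le_rfl⟩ x
      · exact hFsm.continuousOn.mono (prod_mono hIcc Subset.rfl)
      · intro s hs
        exact (hFsm.contDiff_slice (hIcc ⟨hs.1.le, hs.2⟩)).of_le (by norm_cast)
      · intro s hs y
        exact hFsm.hasDerivAt_timeLine isOpen_Iio (hIcc ⟨hs.1.le, hs.2⟩) y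
      · intro s hs y
        have hs0 : s < 0 := hIcc ⟨hs.1.le, hs.2⟩
        have hms : 0 < -s := neg_pos.2 hs0
        have e := hFpde s hs0 y
        have hu : ‖u s y‖ ≤ K := by
          have h1 := hA.norm_le hs0 y
          have h2 : C / Real.sqrt (-s) ≤ C / Real.sqrt (-t) :=
            div_le_div_of_nonneg_left hC0 (Real.sqrt_pos.2 ht0)
              (Real.sqrt_le_sqrt (by linarith [hs.2]))
          exact h1.trans h2
        have hdrift : -(fderiv ℝ (F s) y (u s y)) ≤ K * (1 + ‖y‖) * ‖fderiv ℝ (F s) y‖ := by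
          calc -(fderiv ℝ (F s) y (u s y)) ≤ |fderiv ℝ (F s) y (u s y)| := neg_le_abs _
            _ = ‖fderiv ℝ (F s) y (u s y)‖ := (Real.norm_eq_abs _).symm
            _ ≤ ‖fderiv ℝ (F s) y‖ * ‖u s y‖ := ContinuousLinearMap.le_opNorm _ _
            _ ≤ ‖fderiv ℝ (F s) y‖ * K := by gcongr
            _ = K * 1 * ‖fderiv ℝ (F s) y‖ := by ring
            _ ≤ K * (1 + ‖y‖) * ‖fderiv ℝ (F s) y‖ :=
              mul_le_mul_of_nonneg_right
                (mul_le_mul_of_nonneg_left (by linarith [norm_nonneg y]) hK0) (norm_nonneg _)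
        linarith [e, hdrift]
      · intro s hs y
        have hs0 : s < 0 := hIcc hs
        exact (hFbd s hs0 y).trans (div_le_div_of_nonneg_left hA0 ht0 (by linarith [hs.2]))
      · intro y
        exact hFbd T₁ (by linarith) y
    refine le_of_forall_pos_le_add fun ε hε => ?_
    set T₁ : ℝ := min (t - 1) (-(A / ε)) with hT₁
    have hT₁t : T₁ < t := lt_of_le_of_lt (min_le_left _ _) (by linarith)
    have hT₁pos : 0 < -T₁ := by linarith
    have hle : A / ε ≤ -T₁ := by
      have := min_le_right (t - 1) (-(A / ε))
      linarith
    have hAT : A / (-T₁) ≤ ε := by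
      rw [div_le_iff₀ hT₁pos]
      have := (div_le_iff₀ hε).1 hle
      linarith
    linarith [key T₁ hT₁t]
  -- apply to `ω₃` and to `−ω₃`
  set L : (EuclideanSpace ℝ (Fin 3)) →L[ℝ] ℝ := EuclideanSpace.proj (2 : Fin 3) with hL
  have hLu : ∀ s < 0, ∀ z, L (u s z) = 0 := fun s hs z => hh s hs z
  have hnLu : ∀ s < 0, ∀ z, (-L) (u s z) = 0 := fun s hs z => by
    simp [hL, hh s hs z]
  have hpos : curl (u t) x 2 ≤ 0 := by
    refine hmp (fun s y => L (curl (u s) y)) (hvsm.clm L) (hpde L hLu) ?_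
    intro s hs y
    exact (le_abs_self _).trans (hωbd s hs y)
  have hneg : -(curl (u t) x 2) ≤ 0 := by
    refine hmp (fun s y => (-L) (curl (u s) y)) (hvsm.clm (-L)) (hpde (-L) hnLu) ?_
    intro s hs y
    have : (-L) (curl (u s) y) = -(curl (u s) y 2) := by simp [hL]
    rw [this]
    exact (neg_le_abs _).trans (hωbd s hs y)
  linarith

/-! ## The tree does the rest of rung 1a: flat-slice rigidity (PROVED, not a stub) -/

/-- **Flat-slice rigidity (PROVED from the tree).**  A KNSS-gauge Type-I ancient mild field with `u·e₃ ≡ 0`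
whose vertical vorticity vanishes on ONE slice is identically zero: this is
`PoloidalWindowDoorPoloidalWindowRigidityOneSlice.eq_zero_of_flat_slice_single_zero` (class + poloidal on
a slice + `∂₀u₃ ≡ 0` on that slice ⇒ `u ≡ 0`), the flatness `∂₀u₃ = 0` being automatic for a
horizontal-valued field. -/
theorem flatSliceRigidity {C : ℝ} {u : ℝ → (EuclideanSpace ℝ (Fin 3)) → (EuclideanSpace ℝ (Fin 3))} (hu : IsTypeIAncientMild C u)
    (hh : IsHorizontalValued u) {s : ℝ} (hs : s < 0) (hpol : ∀ y, ⟪curl (u s) y, e3⟫_ℝ = 0) :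
    ∀ t < 0, ∀ x, u t x = 0 := by
  have hflat : ∀ y, fderiv ℝ (u s) y (EuclideanSpace.single 0 1) 2 = 0 := by
    intro y
    have hd : DifferentiableAt ℝ (u s) y :=
      ((hu.contDiff_slice hs).differentiable (by simp)).differentiableAt
    set L : (EuclideanSpace ℝ (Fin 3)) →L[ℝ] ℝ := EuclideanSpace.proj (2 : Fin 3) with hL
    have hcomp : HasFDerivAt (fun z => L (u s z)) (L.comp (fderiv ℝ (u s) y)) y :=
      L.hasFDerivAt.comp y hd.hasFDerivAt
    have hzero : (fun z => L (u s z)) = fun _ => (0 : ℝ) := by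
      funext z
      simp [hL, hh s hs z]
    rw [hzero] at hcomp
    have h3 : L.comp (fderiv ℝ (u s) y) = 0 := by
      rw [← hcomp.fderiv]
      simp
    have h4 := congrArg (fun T : (EuclideanSpace ℝ (Fin 3)) →L[ℝ] ℝ => T (EuclideanSpace.single 0 1)) h3
    simpa [hL] using h4
  exact Theorems.PoloidalWindowDoorPoloidalWindowRigidityOneSlice.eq_zero_of_flat_slice_single_zero
    hu.hasTypeITimeDecay hu.continuousOn_uncurry (fun σ τ hστ hτ x => hu.mild_eq_heatExtension hστ hτ x)
    (fun t ht => hu.isDivFree ht) hs hpol hflat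

/-! ## Bounded ⇒ Type I (bridge between the two exact rows, PROVED) -/

/-- A KNSS-gauge Type-I field, shifted so that a slab `t < t₀ < 0` becomes the whole ancient slab, is a
bounded KNSS-gauge ancient mild field. -/
theorem isBoundedKNSSMild_shift {C : ℝ} {u : ℝ → (EuclideanSpace ℝ (Fin 3)) → (EuclideanSpace ℝ (Fin 3))} (hu : IsTypeIAncientMild C u) {t₀ : ℝ}
    (ht₀ : t₀ < 0) : IsBoundedKNSSMild (fun t => u (t + t₀)) := by
  refine ⟨?_, fun t ht => hu.isDivFree (by linarith), fun s t hst ht x => ?_, ?_⟩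
  · -- joint smoothness: compose with the affine map `(t, x) ↦ (t + t₀, x)`
    have hmap : ContDiff ℝ (⊤ : ℕ∞) (fun p : ℝ × (EuclideanSpace ℝ (Fin 3)) => (p.1 + t₀, p.2)) :=
      (contDiff_fst.add contDiff_const).prodMk contDiff_snd
    have hsub : MapsTo (fun p : ℝ × (EuclideanSpace ℝ (Fin 3)) => (p.1 + t₀, p.2)) (Iio 0 ×ˢ univ) (Iio 0 ×ˢ univ) := by
      intro p hp
      refine mk_mem_prod ?_ (mem_univ _)
      have h1 : p.1 < 0 := (mem_prod.1 hp).1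
      show p.1 + t₀ < 0
      linarith
    have h := hu.contDiffOn.comp hmap.contDiffOn hsub
    refine h.congr fun p _ => ?_
    rfl
  · -- the Oseen identity is autonomous
    have h := hu.mild_eq (s := s + t₀) (t := t + t₀) (by linarith) (by linarith) x
    have e1 : t + t₀ - (s + t₀) = t - s := by ring
    rw [e1] at h
    have e2 : oseenDuhamel 1 s (fun τ => u (τ + t₀)) (fun τ => u (τ + t₀)) t x =
        oseenDuhamel 1 (s + t₀) u u (t + t₀) x := by
      have h2 := oseenDuhamel_comp_sub_right 1 s t (-t₀) u u x
      simp only [sub_neg_eq_add] at h2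
      exact h2
    rw [e2]
    exact h
  · -- bounded by `C/√(−t₀)` on the shifted slab
    refine ⟨C / Real.sqrt (-t₀), fun t ht x => ?_⟩
    have h1 := hu.norm_le (t := t + t₀) (by linarith) x
    refine h1.trans ?_
    exact div_le_div_of_nonneg_left hu.nonneg (Real.sqrt_pos.2 (by linarith))
      (Real.sqrt_le_sqrt (by linarith))

end Summit.NavierStokesRegularity.NavierStokesRegularity.Theorems.ScenarioCensus.HorizontalMeter
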